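import Summits.HodgeConjecture.CorCM.OcticWeilMultiPowersHodgeOfMarkman
import Summits.HodgeConjecture.CorCM.OcticWeilMultiFrame
import Summits.HodgeConjecture.CorCM.OcticWeilFourfoldHodgeOfMarkman
import Summits.HodgeConjecture.CorCM.OcticWeilOrbitHodgeOfMarkman
import Summits.HodgeConjecture.CorCM.DecicWeil23MultiHodgeOfMarkman
import HarnessLib

/-!
# COR-CM — the Hodge conjecture for every product of copies of `E, B₁, …, B_r` — ANY NUMBER of CM abelian fourfolds with CM by one
# OCTIC field `K ⊇ i(k)`, of `k`-signature `(2,2)` or `(1,3)`, whose types satisfy the INDEPENDENCE CRITERION — GIVEN ONLY Markman's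
# fourfold / hyperbolic-sixfold theorems and `2`-transitivity of `Aut(ℂ)` on the four embeddings over `τ` (intrinsic and family forms)

Cell `pub-hodgecm2` (COR-CM), seat b30 gen 25 (2026-08-23); count-neutral own lane OCTIC-MULTI (geometry half).  Theorems only; no
definition, no named fact of its own, no `sorry`.  HONEST FRAMING: CONDITIONAL on the displayed named facts
`HodgeTheory.Markman2025_weilClasses_algebraic_abelianFourfold` (demanded only if some listed type has `k`-signature `(2,2)`) and
`HodgeTheory.Markman2025_weilClasses_algebraic_hyperbolicSixfold` (only if some listed type has `k`-signature `(1,3)`), both unrefereed;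
`HC_CM` is not asserted and no case of the Hodge conjecture is claimed unconditionally.  The four-pair twin of gen 24's
`CorCM/DecicWeil23MultiHodgeOfMarkman.lean`.

THE INDEPENDENCE CRITERION (intrinsic).  For CM types `Φ_1, …, Φ_r` of `K` and the four embeddings `s₁, …, s₄` of `K` over `τ`, `hInd`
says: `w + Σ_{m : s ∈ Φ_m} t_m = 0` for all four `s` over `τ` forces `w = t_1 = ⋯ = t_r = 0` — the vectors `𝟙` and `𝟙_{Φ_m ∩ fibre}` in
`ℤ⁴` are linearly independent (so `r ≤ 3`).  By the exact census of gens 19–21 this is exactly the condition under which the Weil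
fourfold / sixfold / eightfold method generates all Hodge classes of all products of copies; it holds e.g. for: one type; a `(2,2)`- and
a `(1,3)`-type; two `(1,3)`-types with distinct `τ`-members; two `(2,2)`-types neither equal nor complementary; three `(2,2)`-types
pairwise meeting in one `τ`-member (ORBIT); two such `(2,2)`-types and a `(1,3)`-type off their common member; a `(2,2)`-type and two
`(1,3)`-types which it separates; THREE `(1,3)`-types with pairwise distinct `τ`-members (new: the lattice of `E × B'₁ × B'₂ × B'₃` is
generated by pairs, three sixfold and six eightfold Weil classes).

* (frame side: `CorCM/OcticWeilMultiFrame.lean` — `exists_frameO` reads ANY family of types at positions `P m a = [e⁻¹(a, +) ∈ Φ_m]`;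
  `card_pos_of_frameO`, `indepPosO_of_frame`.)
* §1 **`hodgeConjectureFor_biproduct_comp_cons_of_markman_indepO`** — `K ⊇ i(k)` octic, `k` imaginary quadratic, `B_m ⊨ (K; Φ_m)`
  (`m < r`) of `k`-signature `(2,2)` or `(1,3)` with `hInd`, `E ⊨ (k; Ψ ∋ τ)`, `Aut(ℂ)` `2`-TRANSITIVE on the embeddings over `τ`
  (`h2T`; relative quartic with group `A₄`/`S₄`; Dodson: automatic when `K` carries a degenerate simple CM fourfold, gen 19's
  `OcticWeilFourfold.twoTransitive_of_isSimple`): for every `κ : Fin N → Fin (r+1)` the Hodge conjecture holds for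
  `⨁_j (E, B₁, …, B_r)(κ j)`; with the `AVDominatedBy` form.
* §2 **THE FAMILY FORMS** `hodgeConjectureFor_of_avDominatedBy_family_conj_of_markman_indepO` (types drawn from the list UP TO COMPLEX
  CONJUGATION — `(3,1)` and complementary `(2,2)` allowed, Deligne 1982 §5 (b) twist `ι ∘ c`), `…family_of_markman_indepO`,
  `hodgeConjectureFor_biproduct_family_of_markman_indepO` (`∏_j A_j` alone).  These SUBSUME the family theorems of gens 20–21
  (`OcticWeilOrbit.hodgeConjectureFor_of_avDominatedBy_family_of_markman`, `OcticWeil13Pair.…family₃…`).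
[cite: Markman2025SurveySecant, Thm. 1.2] [cite: Markman2025SecantWeil, Thm 1.5.1] [cite: Pohlmann1968, Thm 1]
[cite: Shimura1998, §18.2 Lemma (i) and §6.1 Thm. 2 Cor.] [cite: Deligne1982HodgeCycles, §5 (b), (c)] [cite: Schoen1998HodgeWeilAddendum, §10]
[cite: DixonMortimer1996, §2.1] [cite: Dodson1984, §3.3.2 Theorem]

## References
* [Markman2025SurveySecant] E. Markman, arXiv:2509.23403 (unrefereed), Thm. 1.2.  [Markman2025SecantWeil] E. Markman,
  arXiv:2502.03415 (unrefereed), Thm 1.5.1.  [Pohlmann1968] H. Pohlmann, Ann. of Math. 88 (1968), Thm 1.  [Shimura1998] G. Shimura,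
  *Abelian varieties with CM and modular functions*, §18.2 Lemma (i), §6.1 Thm. 2 Cor.  [Deligne1982HodgeCycles] P. Deligne, LNM 900
  (1982), §5 (b), (c).  [Schoen1998HodgeWeilAddendum] C. Schoen, Compositio Math. 114 (1998), §10.  [DixonMortimer1996] J. D. Dixon,
  B. Mortimer, *Permutation Groups*, GTM 163, §2.1.  [Dodson1984] B. Dodson, Trans. AMS 283 (1984), §3.3.2.  [MumfordAV1970] §19.
-/

noncomputable section

open CategoryTheory CategoryTheory.Limits NumberField

namespace Summit.HodgeConjecture.CorCM.OcticWeilMulti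

open Literature.AlgebraicGeometry Literature.AlgebraicGeometry.Motives Literature.AlgebraicGeometry.HodgeTheory
open Literature.AlgebraicGeometry.ComplexMultiplication (IsCMTypeRealisation exists_isCMTypeRealisation)
open Literature.AlgebraicTopology.SingularHomology
open Summit.HodgeConjecture.CorCM.Census.OcticWeilMulti (IndepPosO)
open Summit.HodgeConjecture.CorCM.DecicWeil23Multi (multiSlots)
open Summit.HodgeConjecture.CorCM.DecicWeil23Pair (avDominatedBy_of_cmType_eq)
open Summit.HodgeConjecture.CorCM.OcticCurveFourfold (exists_delta_of_mem)
open Summit.HodgeConjecture.CorCM.Domination (AVDominatedBy)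
open Summit.HodgeConjecture.CorCM.AndreRiemann (sumFam avDominatedBy_prod_of_biproduct avDominatedBy_biproduct_reindex)

open scoped Classical

/-! ## §1 The intrinsic theorem -/

section Main

variable {K : Type} [Field K] [NumberField K] [IsCMField K] {k : Type} [Field k] [NumberField k] [IsCMField k] {N r : ℕ}
  {Φ : Fin r → CMType K} {B : Fin r → AbelianVariety ℂ}
  {ιB : ∀ m, 𝓞 K →+* End (B m)} {θB : ∀ m, K →+* Module.End ℂ (complexBetti (B m).X 1)}
  {Ψ : CMType k} {E : AbelianVariety ℂ} {ιE : 𝓞 k →+* End E} {θE : k →+* Module.End ℂ (complexBetti E.X 1)}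

/-- **THE HODGE CONJECTURE FOR EVERY PRODUCT OF COPIES OF `E, B₁, …, B_r`, GIVEN ONLY Markman's fourfold / hyperbolic-sixfold
theorems.**  `K ⊇ i(k)` a CM field of degree `8`, `k` imaginary quadratic, `B_m ⊨ (K; Φ_m)` (`m < r`) CM abelian FOURFOLDS of
`k`-signature `(1,3)` or `(2,2)` (one or two members over `τ`, `hsig`) whose types satisfy the INDEPENDENCE CRITERION `hInd` (the
indicator vectors of the `Φ_m ∩ {s | s ∘ i = τ}` and the constant vector are linearly independent in `ℤ⁴`), `E ⊨ (k; Ψ ∋ τ)`, and `Aut(ℂ)`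
`2`-TRANSITIVE on the four embeddings of `K` over `τ` (`h2T`): for every `κ : Fin N → Fin (r+1)`, every rational `(q,q)`-class on
`⨁_j (E, B₁, …, B_r)(κ j)` is algebraic — Markman's fourfold theorem being demanded only if some `Φ_m` has `k`-signature `(2,2)`, his
sixfold theorem only if some `Φ_m` has `k`-signature `(1,3)`. [cite: Markman2025SurveySecant, Thm. 1.2] [cite: Markman2025SecantWeil, Thm 1.5.1]
[cite: Pohlmann1968, Thm 1] [cite: Deligne1982HodgeCycles, §5 (c)] [cite: Schoen1998HodgeWeilAddendum, §10] [cite: DixonMortimer1996, §2.1] -/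
theorem hodgeConjectureFor_biproduct_comp_cons_of_markman_indepO
    (h8 : Module.finrank ℚ K = 8) (h2 : Module.finrank ℚ k = 2) (i : k →+* K)
    (hB : ∀ m, IsCMTypeRealisation (Φ m) (B m) (ιB m) (θB m))
    (hE : IsCMTypeRealisation Ψ E ιE θE) {τ : k →+* ℂ} (hτΨ : τ ∈ Ψ.1)
    (hW4 : ∀ m, (Finset.univ.filter fun s : K →+* ℂ => s.comp i = τ ∧ s ∈ (Φ m).1).card = 2 →
      Markman2025_weilClasses_algebraic_abelianFourfold)
    (hM6 : ∀ m, (Finset.univ.filter fun s : K →+* ℂ => s.comp i = τ ∧ s ∈ (Φ m).1).card = 1 →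
      Markman2025_weilClasses_algebraic_hyperbolicSixfold)
    (hsig : ∀ m, (Finset.univ.filter fun s : K →+* ℂ => s.comp i = τ ∧ s ∈ (Φ m).1).card = 1 ∨
      (Finset.univ.filter fun s : K →+* ℂ => s.comp i = τ ∧ s ∈ (Φ m).1).card = 2)
    (hInd : ∀ (w : ℤ) (t : Fin r → ℤ), (∀ s : K →+* ℂ, s.comp i = τ → w + ∑ m : Fin r, (if s ∈ (Φ m).1 then t m else 0) = 0) →
      w = 0 ∧ ∀ m, t m = 0)
    (h2T : ∀ s t s' t' : K →+* ℂ, s.comp i = τ → t.comp i = τ → s'.comp i = τ → t'.comp i = τ → s ≠ t → s' ≠ t' →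
      ∃ ρ : ℂ ≃+* ℂ, (ρ : ℂ →+* ℂ).comp s = s' ∧ (ρ : ℂ →+* ℂ).comp t = t')
    (κ : Fin N → Fin (r + 1)) :
    HodgeConjectureFor (⨁ fun j => (Fin.cons E B : Fin (r + 1) → AbelianVariety ℂ) (κ j)).dim
      (⨁ fun j => (Fin.cons E B : Fin (r + 1) → AbelianVariety ℂ) (κ j)).X := by
  have hττ : ComplexEmbedding.conjugate τ ≠ τ := QuarticCM.conjugate_ne τ
  have hk : ∀ σ : k →+* ℂ, σ = τ ∨ σ = ComplexEmbedding.conjugate τ := fun σ =>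
    QuarticCM.eq_or_eq_conjugate_of_quadratic h2 τ σ
  have hΨ : ∀ σ : k →+* ℂ, σ ∈ Ψ.1 ↔ σ = τ := by
    intro σ
    rcases hk σ with rfl | rfl
    · exact ⟨fun _ => rfl, fun _ => hτΨ⟩
    · exact ⟨fun h => absurd h ((Ψ.2 τ).1 hτΨ), fun h => absurd h hττ⟩
  obtain ⟨δ₀, d, hd, hδ₀⟩ := CyclicSextic.exists_sq_eq_neg_nat_of_isTotallyComplex k h2
  obtain ⟨δ, hδ, hτ⟩ := exists_delta_of_mem h2 hd hδ₀ τ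
  obtain ⟨e, P, he_sign, he_conj, hP, hread⟩ := exists_frameO h8 h2 i hττ hk Φ
  -- the weights `w m = #{s over τ | s ∈ Φ_m} ∈ {1, 2}` and the positions
  set w : Fin r → ℕ := fun m => (Finset.univ.filter fun s : K →+* ℂ => s.comp i = τ ∧ s ∈ (Φ m).1).card with hw_def
  have hPcard : ∀ m, ((Finset.univ : Finset (Fin 4)).filter fun a => P m a = true).card = w m :=
    fun m => card_pos_of_frameO he_sign hP m
  have hind := indepPosO_of_frame he_sign hP hInd
  have h2t := OcticWeilFourfold.h2t_of_twoTransitive he_sign h2T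
  let Kf : Fin 2 → Type := Fin.cons k fun _ : Fin 1 => K
  letI instF : ∀ j, Field (Kf j) := fun j =>
    Fin.cases (motive := fun j => Field (Kf j)) ‹Field k› (fun _ => ‹Field K›) j
  letI instN : ∀ j, NumberField (Kf j) := fun j =>
    Fin.cases (motive := fun j => NumberField (Kf j)) ‹NumberField k› (fun _ => ‹NumberField K›) j
  haveI instC : ∀ j, IsCMField (Kf j) := fun j =>
    Fin.cases (motive := fun j => IsCMField (Kf j)) ‹IsCMField k› (fun _ => ‹IsCMField K›) j
  exact hodgeConjectureFor_biproduct_comp_of_frameO_of_markman_h2t (Kf := Kf) (i₀ := 0) (i₁ := 1) (P := P)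
    (A := Fin.cons E B)
    (Φ := Fin.cons (α := fun j : Fin (r + 1) => CMType (Kf (multiSlots r (0 : Fin 2) 1 j))) Ψ fun m => Φ m)
    (ι := Fin.cons (α := fun j : Fin (r + 1) => 𝓞 (Kf (multiSlots r (0 : Fin 2) 1 j)) →+* End ((Fin.cons E B :
      Fin (r + 1) → AbelianVariety ℂ) j)) ιE fun m => ιB m)
    (θ := Fin.cons (α := fun j : Fin (r + 1) => Kf (multiSlots r (0 : Fin 2) 1 j) →+*
      Module.End ℂ (complexBetti ((Fin.cons E B : Fin (r + 1) → AbelianVariety ℂ) j).X 1)) θE fun m => θB m)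
    w (fun m hm => hW4 m hm) (fun m hm => hM6 m hm) κ h8 h2 i hd hδ hτ (Fin.cases hE fun m => hB m) e he_sign he_conj hPcard hsig
    hind (fun m => hread m) hΨ h2t

/-- **The Hodge conjecture for every abelian variety dominated by a product of copies of `E, B₁, …, B_r`** (intrinsic form, modulo the
Markman theorems of the signatures present): abelian subvarieties, quotients and isogeny images of the `E^a × B₁^{n₁} × ⋯ × B_r^{n_r}`.
[cite: Markman2025SurveySecant, Thm. 1.2] [cite: Markman2025SecantWeil, Thm 1.5.1] [cite: MumfordAV1970, §19] -/
theorem hodgeConjectureFor_of_avDominatedBy_comp_cons_of_markman_indepO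
    (h8 : Module.finrank ℚ K = 8) (h2 : Module.finrank ℚ k = 2) (i : k →+* K)
    (hB : ∀ m, IsCMTypeRealisation (Φ m) (B m) (ιB m) (θB m))
    (hE : IsCMTypeRealisation Ψ E ιE θE) {τ : k →+* ℂ} (hτΨ : τ ∈ Ψ.1)
    (hW4 : ∀ m, (Finset.univ.filter fun s : K →+* ℂ => s.comp i = τ ∧ s ∈ (Φ m).1).card = 2 →
      Markman2025_weilClasses_algebraic_abelianFourfold)
    (hM6 : ∀ m, (Finset.univ.filter fun s : K →+* ℂ => s.comp i = τ ∧ s ∈ (Φ m).1).card = 1 →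
      Markman2025_weilClasses_algebraic_hyperbolicSixfold)
    (hsig : ∀ m, (Finset.univ.filter fun s : K →+* ℂ => s.comp i = τ ∧ s ∈ (Φ m).1).card = 1 ∨
      (Finset.univ.filter fun s : K →+* ℂ => s.comp i = τ ∧ s ∈ (Φ m).1).card = 2)
    (hInd : ∀ (w : ℤ) (t : Fin r → ℤ), (∀ s : K →+* ℂ, s.comp i = τ → w + ∑ m : Fin r, (if s ∈ (Φ m).1 then t m else 0) = 0) →
      w = 0 ∧ ∀ m, t m = 0)
    (h2T : ∀ s t s' t' : K →+* ℂ, s.comp i = τ → t.comp i = τ → s'.comp i = τ → t'.comp i = τ → s ≠ t → s' ≠ t' →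
      ∃ ρ : ℂ ≃+* ℂ, (ρ : ℂ →+* ℂ).comp s = s' ∧ (ρ : ℂ →+* ℂ).comp t = t')
    (κ : Fin N → Fin (r + 1)) {X : AbelianVariety ℂ}
    (hX : AVDominatedBy X (⨁ fun j => (Fin.cons E B : Fin (r + 1) → AbelianVariety ℂ) (κ j))) :
    HodgeConjectureFor X.dim X.X :=
  Domination.hodgeConjectureFor_of_avDominatedBy
    (hodgeConjectureFor_biproduct_comp_cons_of_markman_indepO h8 h2 i hB hE hτΨ hW4 hM6 hsig hInd h2T κ) hX

/-! ## §2 The family forms -/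

variable {n : ℕ} {Θ : Fin n → CMType K} {A : Fin n → AbelianVariety ℂ} {ι : ∀ j, 𝓞 K →+* End (A j)}
  {θ : ∀ j, K →+* Module.End ℂ (complexBetti (A j).X 1)}

/-- **THE FAMILY FORM, TYPES UP TO COMPLEX CONJUGATION.**  `K ⊇ i(k)` ANY CM field of degree `8` over the imaginary quadratic `k` with
`Aut(ℂ)` `2`-transitive on the four embeddings over `τ`; `Φ_1, …, Φ_r` a list of CM types of `K` of `k`-signature `(1,3)` or `(2,2)`
satisfying the INDEPENDENCE CRITERION `hInd`; `A_j ⊨ (K; Θ_j)` (`j < n`) CM abelian fourfolds each of whose types is one of the `Φ_m`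
OR THE CONJUGATE `Φ̄_m = {s | s̄ ∈ Φ_m}` of one (`k`-signature `(3,1)` resp. the complementary `(2,2)`-type; e.g. the complex-conjugate
variety); `E ⊨ (k; Ψ ∋ τ)`.  Then every `C` dominated by `E^a × ∏_j A_j` satisfies the Hodge conjecture, GIVEN ONLY Markman's fourfold
theorem (if a `(2,2)`-type is listed) and hyperbolic-sixfold theorem (if a `(1,3)`-type is listed): `A_j ⊨ (K; Φ̄_m)` realises `Φ_m`
through the twisted action `ι ∘ c` (Deligne 1982 §5 (b)), so each `A_j` is isogenous to the Shimura representative of a listed type.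
[cite: Markman2025SurveySecant, Thm. 1.2] [cite: Markman2025SecantWeil, Thm 1.5.1] [cite: Deligne1982HodgeCycles, §5 (b)]
[cite: Shimura1998, §6.1 Thm. 2 Cor.] [cite: MumfordAV1970, §19] -/
theorem hodgeConjectureFor_of_avDominatedBy_family_conj_of_markman_indepO
    (h8 : Module.finrank ℚ K = 8) (h2 : Module.finrank ℚ k = 2) (i : k →+* K)
    (hA : ∀ j, IsCMTypeRealisation (Θ j) (A j) (ι j) (θ j)) {τ : k →+* ℂ} (Φ : Fin r → CMType K)
    (hW4 : ∀ m, (Finset.univ.filter fun s : K →+* ℂ => s.comp i = τ ∧ s ∈ (Φ m).1).card = 2 →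
      Markman2025_weilClasses_algebraic_abelianFourfold)
    (hM6 : ∀ m, (Finset.univ.filter fun s : K →+* ℂ => s.comp i = τ ∧ s ∈ (Φ m).1).card = 1 →
      Markman2025_weilClasses_algebraic_hyperbolicSixfold)
    (hsig : ∀ m, (Finset.univ.filter fun s : K →+* ℂ => s.comp i = τ ∧ s ∈ (Φ m).1).card = 1 ∨
      (Finset.univ.filter fun s : K →+* ℂ => s.comp i = τ ∧ s ∈ (Φ m).1).card = 2)
    (hInd : ∀ (w : ℤ) (t : Fin r → ℤ), (∀ s : K →+* ℂ, s.comp i = τ → w + ∑ m : Fin r, (if s ∈ (Φ m).1 then t m else 0) = 0) →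
      w = 0 ∧ ∀ m, t m = 0)
    (hpos : ∀ j, ∃ m, Θ j = Φ m ∨ ∀ s : K →+* ℂ, s ∈ (Θ j).1 ↔ ComplexEmbedding.conjugate s ∈ (Φ m).1)
    (h2T : ∀ s t s' t' : K →+* ℂ, s.comp i = τ → t.comp i = τ → s'.comp i = τ → t'.comp i = τ → s ≠ t → s' ≠ t' →
      ∃ ρ : ℂ ≃+* ℂ, (ρ : ℂ →+* ℂ).comp s = s' ∧ (ρ : ℂ →+* ℂ).comp t = t')
    (hE : IsCMTypeRealisation Ψ E ιE θE) (hτΨ : τ ∈ Ψ.1) (a : ℕ)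
    {C : AbelianVariety ℂ} (hC : AVDominatedBy C ((⨁ fun _ : Fin a => E).prod (⨁ A))) :
    HodgeConjectureFor C.dim C.X := by
  -- representatives of the listed types (Shimura)
  have hrep : ∀ m : Fin r, ∃ (Bm : AbelianVariety ℂ) (ιm : 𝓞 K →+* End Bm) (θm : K →+* Module.End ℂ (complexBetti Bm.X 1)),
      IsCMTypeRealisation (Φ m) Bm ιm θm := fun m => exists_isCMTypeRealisation (Φ m)
  choose B ιB θB hB using hrep
  -- each `A_j` is dominated by the representative of its type (twisting the CM structure by `c` in the conjugate case)
  have hdomB : ∀ j, ∃ m : Fin r, AVDominatedBy (A j) (B m) := by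
    intro j
    obtain ⟨m, hm | hm⟩ := hpos j
    · exact ⟨m, avDominatedBy_of_cmType_eq hm (hA j) (hB m)⟩
    · have hconj : ∀ φ : K →+* ℂ, φ ∈ (Φ m).1 ↔ ComplexEmbedding.conjugate φ ∈ (Θ j).1 := fun φ => by
        rw [hm (ComplexEmbedding.conjugate φ), ComplexEmbedding.involutive_conjugate K φ]
      exact ⟨m, avDominatedBy_of_cmType_eq rfl ((hA j).comp_complexConj hconj) (hB m)⟩
  choose m hm using hdomB
  let Y : Fin (r + 1) → AbelianVariety ℂ := Fin.cons E B
  have hYsucc : ∀ m : Fin r, Y m.succ = B m := fun m => by simp only [Y, Fin.cons_succ]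
  have hd₁ : AVDominatedBy (⨁ fun _ : Fin a => E) (⨁ fun _ : Fin a => Y 0) :=
    AVDominatedBy.biproduct_map fun _ => AVDominatedBy.refl E
  have hd₂ : AVDominatedBy (⨁ A) (⨁ fun j => Y (m j).succ) :=
    AVDominatedBy.biproduct_map fun j => by rw [hYsucc]; exact hm j
  have h₁₂' := avDominatedBy_prod_of_biproduct hd₁ hd₂
  let κ' : Fin a ⊕ Fin n → Fin (r + 1) := Sum.elim (fun _ => 0) fun j => (m j).succ
  have hfam : sumFam (fun _ : Fin a => Y 0) (fun j => Y (m j).succ) = Y ∘ κ' := funext fun x => by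
    cases x <;> rfl
  rw [hfam] at h₁₂'
  have hdom := avDominatedBy_biproduct_reindex finSumFinEquiv.symm h₁₂'
  exact Domination.hodgeConjectureFor_of_avDominatedBy
    (hodgeConjectureFor_biproduct_comp_cons_of_markman_indepO h8 h2 i hB hE hτΨ hW4 hM6 hsig hInd h2T (κ' ∘ finSumFinEquiv.symm))
    (hC.trans hdom)

/-- **THE FAMILY FORM.**  `K ⊇ i(k)` ANY CM field of degree `8` over the imaginary quadratic `k` with `Aut(ℂ)` `2`-transitive on the four
embeddings over `τ`; `Φ_1, …, Φ_r` a list of CM types of `K` of `k`-signature `(1,3)` or `(2,2)` satisfying the INDEPENDENCE CRITERION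
`hInd`; `A_j ⊨ (K; Θ_j)` (`j < n`) CM abelian fourfolds EACH OF WHOSE TYPES IS ONE OF THE `Φ_m` (coincidences allowed — e.g. Galois
conjugates `σB` of one CM fourfold, with any CM structures and polarisations); `E ⊨ (k; Ψ ∋ τ)`.  Then every `C` dominated by
`E^a × ∏_j A_j` satisfies the Hodge conjecture, GIVEN ONLY the Markman theorems of the signatures listed (representatives `B_m ⊨ (K; Φ_m)`
by Shimura's existence theorem; each `A_j` is isogenous to the representative of its type). [cite: Markman2025SurveySecant, Thm. 1.2]
[cite: Markman2025SecantWeil, Thm 1.5.1] [cite: Shimura1998, §6.1 Thm. 2 Cor.] [cite: MumfordAV1970, §19] -/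
theorem hodgeConjectureFor_of_avDominatedBy_family_of_markman_indepO
    (h8 : Module.finrank ℚ K = 8) (h2 : Module.finrank ℚ k = 2) (i : k →+* K)
    (hA : ∀ j, IsCMTypeRealisation (Θ j) (A j) (ι j) (θ j)) {τ : k →+* ℂ} (Φ : Fin r → CMType K)
    (hW4 : ∀ m, (Finset.univ.filter fun s : K →+* ℂ => s.comp i = τ ∧ s ∈ (Φ m).1).card = 2 →
      Markman2025_weilClasses_algebraic_abelianFourfold)
    (hM6 : ∀ m, (Finset.univ.filter fun s : K →+* ℂ => s.comp i = τ ∧ s ∈ (Φ m).1).card = 1 →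
      Markman2025_weilClasses_algebraic_hyperbolicSixfold)
    (hsig : ∀ m, (Finset.univ.filter fun s : K →+* ℂ => s.comp i = τ ∧ s ∈ (Φ m).1).card = 1 ∨
      (Finset.univ.filter fun s : K →+* ℂ => s.comp i = τ ∧ s ∈ (Φ m).1).card = 2)
    (hInd : ∀ (w : ℤ) (t : Fin r → ℤ), (∀ s : K →+* ℂ, s.comp i = τ → w + ∑ m : Fin r, (if s ∈ (Φ m).1 then t m else 0) = 0) →
      w = 0 ∧ ∀ m, t m = 0)
    (hpos : ∀ j, ∃ m, Θ j = Φ m)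
    (h2T : ∀ s t s' t' : K →+* ℂ, s.comp i = τ → t.comp i = τ → s'.comp i = τ → t'.comp i = τ → s ≠ t → s' ≠ t' →
      ∃ ρ : ℂ ≃+* ℂ, (ρ : ℂ →+* ℂ).comp s = s' ∧ (ρ : ℂ →+* ℂ).comp t = t')
    (hE : IsCMTypeRealisation Ψ E ιE θE) (hτΨ : τ ∈ Ψ.1) (a : ℕ)
    {C : AbelianVariety ℂ} (hC : AVDominatedBy C ((⨁ fun _ : Fin a => E).prod (⨁ A))) :
    HodgeConjectureFor C.dim C.X :=
  hodgeConjectureFor_of_avDominatedBy_family_conj_of_markman_indepO h8 h2 i hA Φ hW4 hM6 hsig hInd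
    (fun j => (hpos j).imp fun _ hm => Or.inl hm) h2T hE hτΨ a hC

/-- **In particular: the Hodge conjecture for `∏_j A_j` itself** — any finite product of CM abelian fourfolds over `K` whose types are drawn
from an independent list — e.g. `B'₁ × B'₂ × B'₃` for three `(1,3)`-types with distinct `τ`-members, the carrier of the six EIGHTFOLD Weil
classes of the `B'_l × B̄'_m` — GIVEN ONLY the Markman theorems of the signatures listed (`E` enters through Shimura's existence theorem
only). [cite: Markman2025SurveySecant, Thm. 1.2] [cite: Markman2025SecantWeil, Thm 1.5.1] [cite: MumfordAV1970, §19] -/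
theorem hodgeConjectureFor_biproduct_family_of_markman_indepO
    (h8 : Module.finrank ℚ K = 8) (h2 : Module.finrank ℚ k = 2) (i : k →+* K)
    (hA : ∀ j, IsCMTypeRealisation (Θ j) (A j) (ι j) (θ j)) {τ : k →+* ℂ} (Φ : Fin r → CMType K)
    (hW4 : ∀ m, (Finset.univ.filter fun s : K →+* ℂ => s.comp i = τ ∧ s ∈ (Φ m).1).card = 2 →
      Markman2025_weilClasses_algebraic_abelianFourfold)
    (hM6 : ∀ m, (Finset.univ.filter fun s : K →+* ℂ => s.comp i = τ ∧ s ∈ (Φ m).1).card = 1 →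
      Markman2025_weilClasses_algebraic_hyperbolicSixfold)
    (hsig : ∀ m, (Finset.univ.filter fun s : K →+* ℂ => s.comp i = τ ∧ s ∈ (Φ m).1).card = 1 ∨
      (Finset.univ.filter fun s : K →+* ℂ => s.comp i = τ ∧ s ∈ (Φ m).1).card = 2)
    (hInd : ∀ (w : ℤ) (t : Fin r → ℤ), (∀ s : K →+* ℂ, s.comp i = τ → w + ∑ m : Fin r, (if s ∈ (Φ m).1 then t m else 0) = 0) →
      w = 0 ∧ ∀ m, t m = 0)
    (hpos : ∀ j, ∃ m, Θ j = Φ m)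
    (h2T : ∀ s t s' t' : K →+* ℂ, s.comp i = τ → t.comp i = τ → s'.comp i = τ → t'.comp i = τ → s ≠ t → s' ≠ t' →
      ∃ ρ : ℂ ≃+* ℂ, (ρ : ℂ →+* ℂ).comp s = s' ∧ (ρ : ℂ →+* ℂ).comp t = t')
    (hE : IsCMTypeRealisation Ψ E ιE θE) (hτΨ : τ ∈ Ψ.1) :
    HodgeConjectureFor (⨁ A).dim (⨁ A).X :=
  hodgeConjectureFor_of_avDominatedBy_family_of_markman_indepO h8 h2 i hA Φ hW4 hM6 hsig hInd hpos h2T hE hτΨ 0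
    (C := ⨁ A) ⟨AbelianVariety.prodLift 0 (𝟙 _), AbelianVariety.snd _ _, 1, one_ne_zero, by
      rw [AbelianVariety.prodLift_snd, one_smul]⟩

end Main

end Summit.HodgeConjecture.CorCM.OcticWeilMulti

end
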